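import Summits.ValiantsHypothesis.ValiantsHypothesis.Theses.SOSTau

/-!
# Strategist sketch for crux `SOSTau` (stmt-ValiantsHypothesis-18748) — signatures quoted in STRATEGY-CENSUS.md

Nothing here is registered; every `def` is a candidate statement discussed in the census
(transfer / strengthen / decomposition / negation), typed over existing declarations so that the
census quotes elaborating Lean.  Proofs marked `sorry` are deliberately NOT claimed.
-/

set_option linter.unusedVariables false
set_option linter.dupNamespace false

namespace Summit.ValiantsHypothesis.ValiantsHypothesis.Cruxes.SOSTau.Census

open Polynomial
open scoped BigOperators

/-- The crux, by name. -/
abbrev Crux : Prop := Summit.ValiantsHypothesis.ValiantsHypothesis.Theses.SOSTau.SOSTau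

/-! ## Normal form (bookkeeping only): positive zeros -/

/-- Positive-zeros form: implies `Crux` with `c ↦ 2c + 1` (apply to `g i ∘ (−X)`, add the zero `0`). -/
def SOSTauPos : Prop :=
  ∃ c : ℕ, ∀ (s : ℕ) (a : Fin s → ℝ) (g : Fin s → ℝ[X]),
    ((∑ i, C (a i) * g i ^ 2).roots.toFinset.filter (fun x => 0 < x)).card ≤ c * ∑ i, (g i).support.card

/-! ## TRANSFER: the equivalent product form (linear real τ at product-depth two) -/

/-- `Σ_i g_i h_i` has `O(Σ (|supp g_i| + |supp h_i|))` distinct real zeros.  Equivalent to `Crux`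
up to the constant (squares are products; `4gh = (g+h)² − (g−h)²`). -/
def LinRealTauTwo : Prop :=
  ∃ c : ℕ, ∀ (s : ℕ) (g h : Fin s → ℝ[X]),
    (∑ i, g i * h i).roots.toFinset.card ≤ c * ∑ i, ((g i).support.card + (h i).support.card)

/-- The cheap direction, proved: the product form implies the crux (with constant `2c`). -/
theorem crux_of_linRealTauTwo (h : LinRealTauTwo) : Crux := by
  obtain ⟨c, hc⟩ := h
  refine ⟨2 * c, fun s a g => ?_⟩
  have key := hc s g (fun i => C (a i) * g i)
  have hrw : (∑ i, g i * (C (a i) * g i)) = ∑ i, C (a i) * g i ^ 2 := by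
    refine Finset.sum_congr rfl (fun i _ => ?_); ring
  rw [hrw] at key
  refine key.trans ?_
  have hsupp : ∀ i, (C (a i) * g i).support ⊆ (g i).support := fun i n hn => by
    rw [mem_support_iff] at hn ⊢
    rw [coeff_C_mul] at hn
    exact right_ne_zero_of_mul hn
  calc c * ∑ i, ((g i).support.card + (C (a i) * g i).support.card)
      ≤ c * ∑ i, ((g i).support.card + (g i).support.card) := by
        gcongr with i
        exact hsupp i
    _ = 2 * c * ∑ i, (g i).support.card := by
        rw [Finset.mul_sum, Finset.mul_sum]
        refine Finset.sum_congr rfl (fun i _ => ?_); ring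

/-! ## STRENGTHEN 1: Hrubeš's sector-discrepancy form (equivalent to `Crux` by the argument of
Hrubeš 2013 Thm 2.3, which uses only closure of the class under `f ↦ Re f(x e^{iφ})`; for weighted
sums of squares `Re (a (u+iv)²) = a(u² − v²)`, support-sum `× 2`). -/

/-- Number of complex roots (with multiplicity) of `F` in the open sector `β < arg z < α`. -/
noncomputable def sectorCount (F : ℂ[X]) (α β : ℝ) : ℕ :=
  Multiset.card (F.roots.filter (fun z => β < Complex.arg z ∧ Complex.arg z < α))

/-- Sector form: the arguments of the complex roots of a nonzero weighted sum of sparse squares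
with `F(0) ≠ 0` are equidistributed up to an error linear in the support-sum. -/
def SectorSOSTau : Prop :=
  ∃ c : ℕ, ∀ (s : ℕ) (a : Fin s → ℝ) (g : Fin s → ℝ[X]) (α β : ℝ),
    β < α → α - β ≤ 2 * Real.pi →
    (∑ i, C (a i) * g i ^ 2).eval 0 ≠ 0 →
      |(sectorCount ((∑ i, C (a i) * g i ^ 2).map (algebraMap ℝ ℂ)) α β : ℝ)
        - (α - β) / (2 * Real.pi) * ((∑ i, C (a i) * g i ^ 2).natDegree : ℝ)|
        ≤ c * ∑ i, ((g i).support.card : ℝ)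

/-! ## STRENGTHEN 2 (really a CONSEQUENCE — weakest unknown consequence): multiplicity shadow -/

/-- A nonzero weighted sum of sparse squares vanishes at a nonzero point to order `O(support-sum)`.
(Counting ALL roots with multiplicity is refuted: `not_sosTau_with_multiplicity`; this is the
one-point version, implied by `Crux` via the sector form / Dutta L9–L10.) -/
def MultShadow : Prop :=
  ∃ c : ℕ, ∀ (s : ℕ) (a : Fin s → ℝ) (g : Fin s → ℝ[X]) (r : ℝ), r ≠ 0 →
    (∑ i, C (a i) * g i ^ 2) ≠ 0 →
      (∑ i, C (a i) * g i ^ 2).rootMultiplicity r ≤ c * ∑ i, (g i).support.card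

/-- Dutta 2021 Lemma 9 target, complex and unweighted: `(X+1)^d` needs linear sparse-SOS support.
Refuting it refutes `Crux` (first lemma of the negation line below). -/
def BinomialPowerSOSHard : Prop :=
  ∃ c : ℕ, ∀ (d s : ℕ) (q : Fin s → ℂ[X]),
    (∑ i, q i ^ 2) = (X + 1) ^ d → d ≤ c * ∑ i, (q i).support.card + 1

/-- FIRST LEMMA of the negation line (Dutta 2021 L9 + L10: `g_d = f(iX) + f(−iX)` is real with
`2⌊d/2⌋` distinct real zeros `tan((2k+1)π/2d)`; a complex SOS of `(X+1)^d` gives a real weighted SOS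
of `g_d` of `4×` the support).  Provable now (M/L); NOT proved here. -/
theorem binomialPowerSOSHard_of_crux : Crux → BinomialPowerSOSHard := by
  sorry

/-! ## STRENGTHEN 3: Chebyshev-sharp constant (rigidity form) -/

/-- `Z ≤ 4·S + C₀`: the constant of the Chebyshev doubling `T_{2m} = 2T_m² − 1` is extremal. -/
def SOSTauSharp : Prop :=
  ∃ C₀ : ℕ, ∀ (s : ℕ) (a : Fin s → ℝ) (g : Fin s → ℝ[X]),
    (∑ i, C (a i) * g i ^ 2).roots.toFinset.card ≤ 4 * ∑ i, (g i).support.card + C₀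

theorem crux_of_sharp (h : SOSTauSharp) : Crux := by
  obtain ⟨C₀, hC⟩ := h
  refine ⟨4 + C₀, fun s a g => ?_⟩
  rcases Nat.eq_zero_or_pos (∑ i, (g i).support.card) with h0 | hpos
  · -- all supports empty: every `g i = 0`, the sum is `0`, no roots
    have hg : ∀ i, g i = 0 := fun i => by
      have := Finset.sum_eq_zero_iff.mp h0 i (Finset.mem_univ i)
      simpa using this
    simp [hg]
  · exact (hC s a g).trans (by nlinarith)

/-! ## DECOMPOSITION: the best typed split found (= the opener's birth skeleton, cited not re-filed).
Piece 1 is provable; piece 2 is the whole crux restricted to near-tie points, i.e. the crux. -/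

/-- The value of the monomial term `|a_i| (g_i)_e² x^{2e}` ("square-monomial size"). -/
noncomputable def sqMonoVal {s : ℕ} (a : Fin s → ℝ) (g : Fin s → ℝ[X]) (i : Fin s) (e : ℕ) (x : ℝ) : ℝ :=
  |a i| * ((g i).coeff e) ^ 2 * x ^ (2 * e)

/-- Piece 1 (provable, M): at a positive zero the top square-monomial is matched within a factor
`16 S²` by a second one. -/
def NearTieAtZeros : Prop :=
  ∀ (s : ℕ) (a : Fin s → ℝ) (g : Fin s → ℝ[X]) (x : ℝ), 0 < x →
    (∑ i, C (a i) * g i ^ 2) ≠ 0 → (∑ i, C (a i) * g i ^ 2).IsRoot x →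
      ∃ (i j : Fin s) (e e' : ℕ), (i, e) ≠ (j, e') ∧ e ∈ (g i).support ∧ e' ∈ (g j).support ∧
        (∀ (k : Fin s) (e'' : ℕ), sqMonoVal a g k e'' x ≤ sqMonoVal a g i e x) ∧
        sqMonoVal a g i e x ≤ 16 * ((∑ k, ((g k).support.card : ℝ)) ^ 2) * sqMonoVal a g j e' x

open Classical in
/-- Piece 2 (= the crux on near-tie points; NOT a reduction in difficulty). -/
def TieCount : Prop :=
  ∃ c : ℕ, ∀ (s : ℕ) (a : Fin s → ℝ) (g : Fin s → ℝ[X]),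
    ((∑ i, C (a i) * g i ^ 2).roots.toFinset.filter (fun x => 0 < x ∧
      ∃ (i j : Fin s) (e e' : ℕ), (i, e) ≠ (j, e') ∧ e ∈ (g i).support ∧ e' ∈ (g j).support ∧
        (∀ (k : Fin s) (e'' : ℕ), sqMonoVal a g k e'' x ≤ sqMonoVal a g i e x) ∧
        sqMonoVal a g i e x ≤ 16 * ((∑ k, ((g k).support.card : ℝ)) ^ 2) * sqMonoVal a g j e' x)).card
      ≤ c * ∑ i, (g i).support.card

/-- Glue shape of the split (the composition itself is routine: filter = everything by piece 1,
then the `x ↦ −x` / `x = 0` bookkeeping of `SOSTauPos`).  Stated, not proved here. -/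
def SplitGlue : Prop := NearTieAtZeros → TieCount → Crux

/-! ## NEGATION: the typed obstruction met by every paper construction -/

/-- Ratio `Z/S > 4` forces lacunarity: `Z ≤ deg F ≤ 2 · max deg g_i`, so some `g_i` must have
degree `> 2S`, i.e. density `< 1/4` — parity-sparse (Chebyshev/Dickson) components cannot do it. -/
theorem roots_le_two_mul_natDegree {s : ℕ} (a : Fin s → ℝ) (g : Fin s → ℝ[X]) :
    (∑ i, C (a i) * g i ^ 2).roots.toFinset.card ≤
      2 * Finset.univ.sup (fun i => (g i).natDegree) := by
  calc (∑ i, C (a i) * g i ^ 2).roots.toFinset.card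
      ≤ Multiset.card (∑ i, C (a i) * g i ^ 2).roots := Multiset.toFinset_card_le _
    _ ≤ (∑ i, C (a i) * g i ^ 2).natDegree := Polynomial.card_roots' _
    _ ≤ 2 * Finset.univ.sup (fun i => (g i).natDegree) := by
        refine Polynomial.natDegree_sum_le_of_forall_le _ _ (fun i _ => ?_)
        calc (C (a i) * g i ^ 2).natDegree ≤ (g i ^ 2).natDegree := Polynomial.natDegree_C_mul_le _ _
          _ ≤ 2 * (g i).natDegree := Polynomial.natDegree_pow_le
          _ ≤ 2 * Finset.univ.sup (fun i => (g i).natDegree) :=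
              Nat.mul_le_mul_left 2 (Finset.le_sup (f := fun i => (g i).natDegree) (Finset.mem_univ i))

end Summit.ValiantsHypothesis.ValiantsHypothesis.Cruxes.SOSTau.Census
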